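import Mathlib.Analysis.SpecialFunctions.Exponential
import Mathlib.Analysis.Normed.Module.FiniteDimension
import Mathlib.MeasureTheory.Integral.DominatedConvergence
import Mathlib.MeasureTheory.Integral.IntervalIntegral.FundThmCalculus
import Literature.Analysis.ODE.PicardForcing
import HarnessLib

/-!
# Observability of a linear system from one output over a finite window

Topic `Literature/Analysis/ODE`. For a bounded linear vector field `A : E →L[ℝ] E` on a Banach
space `E` the linear flow is `t ↦ exp(tA) X₀` (`NormedSpace.exp` in the Banach algebra
`E →L[ℝ] E`, applied to the initial condition `X₀`). We record:

* `hasDerivAt_linearFlow`, `continuous_linearFlow(_uncurry)`, `isIntegralSolutionOn_linearFlow`: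
  it is the `C¹`, jointly continuous solution of `Ẋ = AX`, `X(0) = X₀`, i.e. of the integral
  equation `X(t) = X₀ + ∫₀ᵗ A X(s) ds` (an `IsIntegralSolutionOn` of `PicardForcing.lean` with the
  constant forcing `X₀`);
* `IsIntegralSolutionOn.norm_sub_linearFlow_le` — **variation of constants / Grönwall**: a
  continuous solution of the FORCED equation `X(t) = g(t) + ∫₀ᵗ A X(s) ds` on `[0, T]` whose
  forcing satisfies `‖g(t) - X₀‖ ≤ δ` stays within `δ e^{‖A‖ t}` of the free flow from `X₀`;
* `exists_observabilityConstant` — **the observability inequality**: on a finite-dimensional `E`,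
  if an output `C : E →L[ℝ] ℝ` observes the free flow on `[0, τ]`, `τ > 0` — `C exp(tA) X₀ ≡ 0`
  on `[0, τ]` only for `X₀ = 0`, e.g. by Kalman's rank condition — then
  `∫₀^τ (C exp(tA) X₀)² dt ≥ c ‖X₀‖²` for one `c > 0` and all `X₀` (minimise the continuous,
  positive, degree-two homogeneous observation energy over the compact unit sphere);
* `integral_sq_ge_of_abs_sub_le` — the elementary `L²` triangle inequality that transfers such a
  lower bound to any signal `y` with `|y - a| ≤ η` on `[0, τ]`: `∫₀^τ y² ≥ ½ ∫₀^τ a² - τ η²`.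

## References

* E. D. Sontag, *Mathematical Control Theory*, 2nd ed., Springer (1998), §6.1–§6.2 (observability
  and the observability Gramian of a linear system); E. A. Coddington, N. Levinson, *Theory of
  Ordinary Differential Equations* (1955), Ch. 1 §5 and Ch. 3 §1 (Grönwall, linear systems).
  [folklore]

## Design choices

* The flow is Mathlib's `NormedSpace.exp (t • A)` (`hasDerivAt_exp_smul_const'`); the forced
  equation is the tree's `IsIntegralSolutionOn` (`PicardForcing.lean`), whose Grönwall stability
  `IsIntegralSolutionOn.norm_sub_le_mul_exp` is reused, not re-proved. No new definitions.
* NOT here: any specific system (the damped harmonic block of the heat-conduction chains is in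
  `Literature/MathematicalPhysics/KineticTheory/DampedHarmonicBlockObservability.lean`), Kalman's
  rank condition itself, infinite horizons, control / duality.
-/

noncomputable section

open MeasureTheory Set Filter Topology NormedSpace

namespace Literature.Analysis.ODE

variable {E : Type*} [NormedAddCommGroup E] [NormedSpace ℝ E] [CompleteSpace E]

/-! ### The linear flow `exp(tA) X₀` -/

section Flow

variable (A : E →L[ℝ] E)

/-- The linear flow solves `Ẋ = A X`: `d/dt (exp(tA) X₀) = A exp(tA) X₀` at every `t`.
[folklore] -/
theorem hasDerivAt_linearFlow (X₀ : E) (t : ℝ) :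
    HasDerivAt (fun s : ℝ => exp (s • A) X₀) (A (exp (t • A) X₀)) t := by
  have h := (hasDerivAt_exp_smul_const' (𝕂 := ℝ) A t).clm_apply (hasDerivAt_const t X₀)
  simpa using h

/-- The linear flow is jointly continuous in `(t, X₀)`. [folklore] -/
theorem continuous_linearFlow_uncurry : Continuous fun p : ℝ × E => exp (p.1 • A) p.2 :=
  ((differentiable_exp_smul_const ℝ A).continuous.comp continuous_fst).clm_apply continuous_snd

/-- The linear flow is continuous in time. [folklore] -/
theorem continuous_linearFlow (X₀ : E) : Continuous fun t : ℝ => exp (t • A) X₀ :=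
  continuous_iff_continuousAt.2 fun t => (hasDerivAt_linearFlow A X₀ t).continuousAt

omit [CompleteSpace E] in
/-- At time `0` the linear flow is the identity. [folklore] -/
theorem linearFlow_zero (X₀ : E) : exp ((0 : ℝ) • A) X₀ = X₀ := by
  rw [zero_smul, exp_zero]
  rfl

omit [CompleteSpace E] in
/-- The linear flow is linear in the initial condition (scalars). [folklore] -/
theorem linearFlow_smul (X₀ : E) (r t : ℝ) : exp (t • A) (r • X₀) = r • exp (t • A) X₀ :=
  (exp (t • A)).map_smul r X₀

/-- **The linear flow solves the integral equation** `X(t) = X₀ + ∫₀ᵗ A X(s) ds` on every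
`[0, T]` (fundamental theorem of calculus for the `C¹` curve `exp(tA) X₀`). [folklore] -/
theorem isIntegralSolutionOn_linearFlow (X₀ : E) (T : ℝ) :
    IsIntegralSolutionOn A (fun _ => X₀) (fun t => exp (t • A) X₀) T := by
  intro t _
  have hcont : Continuous fun s : ℝ => A (exp (s • A) X₀) :=
    A.continuous.comp (continuous_linearFlow A X₀)
  have h := intervalIntegral.integral_eq_sub_of_hasDerivAt
    (fun s _ => hasDerivAt_linearFlow A X₀ s) (hcont.intervalIntegrable 0 t)
  show exp (t • A) X₀ = X₀ + ∫ s in (0 : ℝ)..t, A (exp (s • A) X₀)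
  rw [h, linearFlow_zero]
  abel

/-- **Grönwall comparison with the free flow (variation of constants).** A continuous solution
of the forced linear equation `X(t) = g(t) + ∫₀ᵗ A X(s) ds` on `[0, T]` whose forcing stays
`δ`-close to `X₀` stays `δ e^{‖A‖ t}`-close to the free flow `exp(tA) X₀`. [folklore] -/
theorem IsIntegralSolutionOn.norm_sub_linearFlow_le {A : E →L[ℝ] E} {g X : ℝ → E} {T δ : ℝ}
    {X₀ : E} (hX : IsIntegralSolutionOn A g X T) (hXc : Continuous X)
    (hδ : ∀ t ∈ Icc 0 T, ‖g t - X₀‖ ≤ δ) :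
    ∀ t ∈ Icc 0 T, ‖X t - exp (t • A) X₀‖ ≤ δ * Real.exp (‖A‖ * t) := by
  have h := IsIntegralSolutionOn.norm_sub_le_mul_exp (S := univ) A.lipschitz.lipschitzOnWith hX
    (isIntegralSolutionOn_linearFlow A X₀ T) hXc (continuous_linearFlow A X₀)
    (fun _ _ => mem_univ _) (fun _ _ => mem_univ _) hδ
  simpa using h

end Flow

/-! ### The observability inequality -/

section Observability

variable (A : E →L[ℝ] E) (C : E →L[ℝ] ℝ)

/-- The observation energy `X₀ ↦ ∫₀^τ (C exp(tA) X₀)² dt` is continuous (a parametric interval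
integral with a jointly continuous integrand). [folklore] -/
theorem continuous_observationEnergy (τ : ℝ) :
    Continuous fun X₀ : E => ∫ t in (0 : ℝ)..τ, (C (exp (t • A) X₀)) ^ 2 := by
  refine intervalIntegral.continuous_parametric_intervalIntegral_of_continuous' ?_ 0 τ
  have h1 : Continuous fun p : E × ℝ => exp (p.2 • A) p.1 :=
    (continuous_linearFlow_uncurry A).comp (continuous_snd.prodMk continuous_fst)
  exact (C.continuous.comp h1).pow 2

omit [CompleteSpace E] in
/-- The observation energy is homogeneous of degree two in the initial condition. [folklore] -/
theorem observationEnergy_smul (τ r : ℝ) (X₀ : E) :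
    ∫ t in (0 : ℝ)..τ, (C (exp (t • A) (r • X₀))) ^ 2 =
      r ^ 2 * ∫ t in (0 : ℝ)..τ, (C (exp (t • A) X₀)) ^ 2 := by
  rw [← intervalIntegral.integral_const_mul]
  refine intervalIntegral.integral_congr fun t _ => ?_
  simp only [map_smul, smul_eq_mul]
  ring

omit [CompleteSpace E] in
/-- The observation energy over `[0, τ]`, `τ ≥ 0`, is nonnegative. [folklore] -/
theorem observationEnergy_nonneg {τ : ℝ} (hτ : 0 ≤ τ) (X₀ : E) :
    0 ≤ ∫ t in (0 : ℝ)..τ, (C (exp (t • A) X₀)) ^ 2 :=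
  intervalIntegral.integral_nonneg hτ fun _ _ => sq_nonneg _

/-- A nonzero observation somewhere on `[0, τ]`, `τ > 0`, makes the observation energy positive
(the integrand is continuous and nonnegative). [folklore] -/
theorem observationEnergy_pos {τ : ℝ} (hτ : 0 < τ) {X₀ : E}
    (h : ∃ t ∈ Icc 0 τ, C (exp (t • A) X₀) ≠ 0) :
    0 < ∫ t in (0 : ℝ)..τ, (C (exp (t • A) X₀)) ^ 2 := by
  obtain ⟨t₀, ht₀, hne⟩ := h
  have hc : Continuous fun t : ℝ => (C (exp (t • A) X₀)) ^ 2 :=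
    (C.continuous.comp (continuous_linearFlow A X₀)).pow 2
  have hlt := intervalIntegral.integral_lt_integral_of_continuousOn_of_le_of_exists_lt hτ
    continuousOn_const hc.continuousOn (fun _ _ => sq_nonneg _)
    ⟨t₀, ht₀, lt_of_le_of_ne (sq_nonneg _) (Ne.symm (pow_ne_zero 2 hne))⟩
  simpa using hlt

/-- **The observability inequality over a finite window.** On a finite-dimensional space, if the
output `C` observes the linear flow of `A` on `[0, τ]`, `τ > 0` — the only initial condition whose
free output `C exp(tA) X₀` vanishes identically on `[0, τ]` is `X₀ = 0` — then the observation
energy dominates the squared norm: `c ‖X₀‖² ≤ ∫₀^τ (C exp(tA) X₀)² dt` for one `c > 0` and all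
`X₀`. Proof: the energy is continuous, degree-two homogeneous and positive on the compact unit
sphere, so its minimum `c` there is positive. Sontag, *Mathematical Control Theory* (1998),
§6.2 (the observability Gramian is positive definite). [folklore] -/
theorem exists_observabilityConstant [FiniteDimensional ℝ E] {τ : ℝ} (hτ : 0 < τ)
    (hobs : ∀ X₀ : E, (∀ t ∈ Icc 0 τ, C (exp (t • A) X₀) = 0) → X₀ = 0) :
    ∃ c : ℝ, 0 < c ∧ ∀ X₀ : E, c * ‖X₀‖ ^ 2 ≤ ∫ t in (0 : ℝ)..τ, (C (exp (t • A) X₀)) ^ 2 := by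
  haveI : ProperSpace E := FiniteDimensional.proper ℝ E
  rcases subsingleton_or_nontrivial E with hE | hE
  · refine ⟨1, one_pos, fun X₀ => ?_⟩
    rw [Subsingleton.elim X₀ 0, norm_zero, sq, mul_zero, mul_zero]
    exact observationEnergy_nonneg A C hτ.le 0
  set F : E → ℝ := fun X₀ => ∫ t in (0 : ℝ)..τ, (C (exp (t • A) X₀)) ^ 2 with hF
  have hFc : Continuous F := continuous_observationEnergy A C τ
  obtain ⟨Xm, hXm, hmin⟩ := (isCompact_sphere (0 : E) 1).exists_isMinOn
    (NormedSpace.sphere_nonempty.2 zero_le_one) hFc.continuousOn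
  have hXm1 : ‖Xm‖ = 1 := mem_sphere_zero_iff_norm.1 hXm
  refine ⟨F Xm, ?_, fun X₀ => ?_⟩
  · refine observationEnergy_pos A C hτ ?_
    by_contra hcon
    have h0 : Xm = 0 := hobs Xm fun t ht => not_not.1 fun hne => hcon ⟨t, ht, hne⟩
    rw [h0, norm_zero] at hXm1
    exact zero_ne_one hXm1
  · by_cases hX : X₀ = 0
    · rw [hX, norm_zero, sq, mul_zero, mul_zero]
      exact observationEnergy_nonneg A C hτ.le 0
    · have hr : 0 < ‖X₀‖ := norm_pos_iff.2 hX
      have hmem : ‖X₀‖⁻¹ • X₀ ∈ Metric.sphere (0 : E) 1 := by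
        rw [mem_sphere_zero_iff_norm, norm_smul, norm_inv, norm_norm, inv_mul_cancel₀ hr.ne']
      have h1 : F Xm ≤ F (‖X₀‖⁻¹ • X₀) := hmin hmem
      have h2 : F (‖X₀‖⁻¹ • X₀) = ‖X₀‖⁻¹ ^ 2 * F X₀ := observationEnergy_smul A C τ _ X₀
      rw [h2] at h1
      calc F Xm * ‖X₀‖ ^ 2 ≤ ‖X₀‖⁻¹ ^ 2 * F X₀ * ‖X₀‖ ^ 2 :=
            mul_le_mul_of_nonneg_right h1 (sq_nonneg _)
        _ = F X₀ := by field_simp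

end Observability

/-! ### Transfer to a nearby signal -/

/-- **`L²` triangle inequality on a window.** If `|y - a| ≤ η` on `[0, τ]` (`τ ≥ 0`, `a`, `y`
continuous) then `∫₀^τ y² ≥ ½ ∫₀^τ a² - τ η²` (pointwise `y² ≥ ½ a² - (y - a)²`). [folklore] -/
theorem integral_sq_ge_of_abs_sub_le {τ η : ℝ} (hτ : 0 ≤ τ) {a y : ℝ → ℝ} (ha : Continuous a)
    (hy : Continuous y) (hη : ∀ t ∈ Icc 0 τ, |y t - a t| ≤ η) :
    (1 / 2) * (∫ t in (0 : ℝ)..τ, a t ^ 2) - τ * η ^ 2 ≤ ∫ t in (0 : ℝ)..τ, y t ^ 2 := by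
  have hpt : ∀ t ∈ Icc 0 τ, (1 / 2) * a t ^ 2 - η ^ 2 ≤ y t ^ 2 := by
    intro t ht
    have h1 : (y t - a t) ^ 2 ≤ η ^ 2 := by
      rw [← sq_abs (y t - a t)]
      exact pow_le_pow_left₀ (abs_nonneg _) (hη t ht) 2
    nlinarith [sq_nonneg (2 * y t - a t)]
  have hi1 : IntervalIntegrable (fun t => (1 / 2) * a t ^ 2 - η ^ 2) volume 0 τ :=
    (((ha.pow 2).const_mul _).sub continuous_const).intervalIntegrable 0 τ
  have hi2 : IntervalIntegrable (fun t => y t ^ 2) volume 0 τ := (hy.pow 2).intervalIntegrable 0 τ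
  have hmono := intervalIntegral.integral_mono_on hτ hi1 hi2 hpt
  have hsplit : ∫ t in (0 : ℝ)..τ, ((1 / 2) * a t ^ 2 - η ^ 2) =
      (1 / 2) * (∫ t in (0 : ℝ)..τ, a t ^ 2) - τ * η ^ 2 := by
    have hia : IntervalIntegrable (fun t => (1 / 2) * a t ^ 2) volume 0 τ :=
      ((ha.pow 2).const_mul _).intervalIntegrable 0 τ
    have hic : IntervalIntegrable (fun _ => η ^ 2) volume 0 τ := intervalIntegrable_const
    rw [intervalIntegral.integral_sub hia hic, intervalIntegral.integral_const_mul,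
      intervalIntegral.integral_const, sub_zero, smul_eq_mul]
  linarith

end Literature.Analysis.ODE
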